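import Literature.Barriers.AnomalousDissipation.ConvexIntegrationNonLerayProofs
import Literature.Analysis.FluidPDE.MollifiedStartTripleBounds
import Literature.Analysis.FluidPDE.TorusPressureReconstruction
import Literature.Analysis.FunctionSpaces.TorusHolderSobolevEmbedding
import HarnessLib

/-!
# Buckmaster–Vicol 2019, Thm. 1.3 — discharge of the mollified Euler start (§2.5, (2.12)–(2.15))

Sibling proof file of `ConvexIntegrationNonLerayProofs`: proves
`BuckmasterVicol2019_mollifiedEulerStart_holds : BuckmasterVicol2019_mollifiedEulerStart`
(Buckmaster–Vicol, Ann. of Math. 189 (2019), §2.5, p. 6 of the held arXiv text 1709.10033: "Let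
`φ_ε`, `ϕ_ε` be standard mollifiers … `v_n = (u ∗ₓ φ_{λ_n^{-1}}) ∗ₜ ϕ_{λ_n^{-1}}` … there exists a
mean-free `p_n` such that `∂ₜv_n + div(v_n ⊗ v_n) + ∇p_n - λ_n^{-2}Δv_n = div R̊_n` … with
estimates (2.12)–(2.15)").

The proof assembles the support files landed for this purpose:
* the datum extended by zero off the slab `[0, 4T]` is bounded Hölder slab data
  (`BV2019.slabData`, `BV2019.exists_holderSlabData`; `Torus.HolderSlabData` of
  `FluidPDE/HolderMollifiedField`), still a weak Euler solution (`isWeakNSSolutionOn_congr`);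
* its space–time mollification at scales `ε = τ = λ^{-1}` has a residual `∂ₜV + div 𝒯`
  orthogonal to divergence-free fields (`FluidPDE/MollifiedWeakEuler`), hence a smooth mean-free
  pressure `q` on `(τ, 4T - τ)` (`FluidPDE/TorusPressureReconstruction`);
* the triple `(V, p, R̊)(· + 2T)` is a Navier–Stokes–Reynolds solution for every `ν`
  (`FluidPDE/MollifiedStartTriple`), with the sup bounds (2.12)–(2.14)
  (`FluidPDE/MollifiedStartTripleBounds`, from the Constantin–E–Titi-type bounds of
  `HolderMollifiedField`);
* `H^{β'}`-closeness (2.15) from `‖V - u‖_{C⁰} ≤ 3Hλ^{-β̄}`, `[V - u]_{r} ≤ 6Hλ^{-(β̄ - r)}`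
  (`r = (β' + β̄)/2`) and the embedding `C^{0,r} ⊂ H^{β'}` on `T³`
  (`FunctionSpaces/TorusHolderSobolevEmbedding`).

No new definitions of mathematical content beyond the zero extension `BV2019.slabData`; no named
facts (net debt `-1`: `BuckmasterVicol2019_mollifiedEulerStart` is discharged).

## References

* T. Buckmaster, V. Vicol, Ann. of Math. 189 (2019), §2.5. [`BuckmasterVicol2019Annals`]
* T. Buckmaster, V. Vicol, EMS Surv. Math. Sci. 6 (2020), Thm. 3.10. [`BuckmasterVicol2020`]
-/

noncomputable section

open MeasureTheory Set Filter Function Metric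
open _root_.Topology
open scoped ENNReal NNReal InnerProductSpace Convolution ContDiff

namespace Literature.Barriers.AnomalousDissipation

open Literature.Analysis.FunctionSpaces Literature.Analysis.FluidPDE

/-- The flat three-torus `T³ = (ℝ/ℤ)³` (local notation). -/
local notation "𝕋³" => UnitAddTorus (Fin 3)
/-- Velocity values (local notation). -/
local notation "ℝ³" => EuclideanSpace ℝ (Fin 3)

namespace BV2019

/-! ## The datum on the slab `[0, 4T]`, extended by zero -/

section SlabData

variable {T : ℝ} {u : ℝ → 𝕋³ → ℝ³}

/-- The datum of Thm. 1.3 read on the slab `[0, 4T]` (i.e. `t ↦ u(t - 2T)`) and extended by zero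
off the slab (Buckmaster–Vicol 2019, §2.5: `u` on `[-2T, 2T]`, mollified in space and time). [cite: BuckmasterVicol2019Annals, §2.5] -/
def slabData (T : ℝ) (u : ℝ → 𝕋³ → ℝ³) : ℝ → 𝕋³ → ℝ³ :=
  fun s => if s ∈ Icc 0 (4 * T) then u (s - 2 * T) else 0

/-- On the slab the extended datum is the shifted datum. [folklore] -/
theorem slabData_of_mem {s : ℝ} (hs : s ∈ Icc 0 (4 * T)) : slabData T u s = u (s - 2 * T) := if_pos hs

/-- Off the slab the extended datum vanishes. [folklore] -/
theorem slabData_of_not_mem {s : ℝ} (hs : s ∉ Icc 0 (4 * T)) : slabData T u s = 0 := if_neg hs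

/-- **The extended datum is bounded Hölder slab data** (`Torus.HolderSlabData`): jointly
measurable (a continuous function on the closed slab, extended by zero), bounded (compact slab),
`β̄`-Hölder on the slab for the sup space–time distance (the hypothesis `HolderOnSpaceTime`). [folklore] -/
theorem exists_holderSlabData (hT : 0 < T) {βb : ℝ≥0} (hβ : 0 < βb) (hβ1 : βb ≤ 1)
    (hH : HolderOnSpaceTime βb (4 * T) (fun t => u (t - 2 * T))) :
    ∃ M H : ℝ, Torus.HolderSlabData (slabData T u) M H βb (4 * T) := by
  obtain ⟨C, hC⟩ := hH
  set f : ℝ × 𝕋³ → ℝ³ := uncurry fun t => u (t - 2 * T) with hf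
  have hT4 : (0 : ℝ) ≤ 4 * T := by positivity
  -- continuity on the slab and the clamped continuous extension
  have hcont : ContinuousOn f (Icc 0 (4 * T) ×ˢ univ) := hC.continuousOn (by exact_mod_cast hβ)
  set cl : ℝ × 𝕋³ → ℝ × 𝕋³ := fun p => (max 0 (min p.1 (4 * T)), p.2) with hcl
  have hcl_cont : Continuous cl := (continuous_const.max (continuous_fst.min continuous_const)).prodMk continuous_snd
  have hcl_mem : ∀ p, cl p ∈ Icc 0 (4 * T) ×ˢ (univ : Set 𝕋³) := fun p =>
    ⟨⟨le_max_left _ _, max_le hT4 (min_le_right _ _)⟩, mem_univ _⟩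
  have hcl_id : ∀ p : ℝ × 𝕋³, p.1 ∈ Icc 0 (4 * T) → cl p = p := by
    rintro ⟨s, y⟩ ⟨hs0, hs1⟩
    simp only [hcl, Prod.mk.injEq, and_true]
    rw [min_eq_left hs1, max_eq_right hs0]
  have hg : Continuous (f ∘ cl) := hcont.comp_continuous hcl_cont hcl_mem
  -- the extended datum as an indicator of the clamped extension
  have hind : uncurry (slabData T u) = (Icc 0 (4 * T) ×ˢ (univ : Set 𝕋³)).indicator (f ∘ cl) := by
    funext p
    obtain ⟨s, y⟩ := p
    by_cases hs : s ∈ Icc 0 (4 * T)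
    · rw [indicator_of_mem (show (s, y) ∈ Icc 0 (4 * T) ×ˢ (univ : Set 𝕋³) from ⟨hs, mem_univ _⟩)]
      simp only [uncurry_apply_pair, Function.comp_apply, slabData_of_mem hs, hcl_id (s, y) hs, hf]
    · rw [indicator_of_notMem (show (s, y) ∉ Icc 0 (4 * T) ×ˢ (univ : Set 𝕋³) from fun h => hs h.1)]
      simp only [uncurry_apply_pair, slabData_of_not_mem hs, Pi.zero_apply]
  -- a bound on the compact slab
  obtain ⟨M₀, hM₀⟩ := (isCompact_Icc.prod isCompact_univ).exists_bound_of_continuousOn hcont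
  refine ⟨max M₀ 0, C, ?_⟩
  refine
    { measurable := ?_
      bound := ?_
      zero_off := fun s hs => slabData_of_not_mem hs
      holder := ?_
      H_nonneg := C.2
      β_pos := by exact_mod_cast hβ
      β_le_one := by exact_mod_cast hβ1 }
  · rw [hind]
    exact hg.stronglyMeasurable.indicator (measurableSet_Icc.prod MeasurableSet.univ)
  · intro s y
    by_cases hs : s ∈ Icc 0 (4 * T)
    · rw [slabData_of_mem hs]
      exact (hM₀ (s, y) ⟨hs, mem_univ _⟩).trans (le_max_left _ _)
    · rw [slabData_of_not_mem hs]
      simp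
  · intro s hs s' hs' y y'
    rw [slabData_of_mem hs, slabData_of_mem hs']
    have h := hC.dist_le (show (s, y) ∈ Icc 0 (4 * T) ×ˢ (univ : Set 𝕋³) from ⟨hs, mem_univ _⟩)
      (show (s', y') ∈ Icc 0 (4 * T) ×ˢ (univ : Set 𝕋³) from ⟨hs', mem_univ _⟩)
    rw [dist_eq_norm, Prod.dist_eq, Real.dist_eq, dist_eq_norm] at h
    exact h

/-- The extended datum is a weak Euler solution on `(0, 4T)` (it agrees with the shifted datum there). [folklore] -/
theorem isWeakEulerSolutionOn_slabData (hE : Torus.IsWeakEulerSolutionOn (4 * T) (fun t => u (t - 2 * T))) :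
    Torus.IsWeakEulerSolutionOn (4 * T) (slabData T u) :=
  isWeakNSSolutionOn_congr (fun _ ht => slabData_of_mem (Ioo_subset_Icc_self ht)) hE

/-- The extended datum is weakly divergence free at a.e. time (on the whole line). [folklore] -/
theorem ae_isWeaklyDivFree_slabData (hE : Torus.IsWeakEulerSolutionOn (4 * T) (slabData T u)) :
    ∀ᵐ s, Torus.IsWeaklyDivFree (slabData T u s) := by
  have h1 : ∀ᵐ s, s ∈ Ioo 0 (4 * T) → Torus.IsWeaklyDivFree (slabData T u s) :=
    (ae_restrict_iff' measurableSet_Ioo).1 hE.2.2.1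
  have h2 : ∀ᵐ s : ℝ, s ∉ ({0, 4 * T} : Set ℝ) :=
    measure_eq_zero_iff_ae_notMem.1 ((Set.toFinite {0, 4 * T}).measure_zero volume)
  filter_upwards [h1, h2] with s hs hs'
  by_cases hmem : s ∈ Icc 0 (4 * T)
  · refine hs ⟨lt_of_le_of_ne hmem.1 ?_, lt_of_le_of_ne hmem.2 ?_⟩
    · intro h; exact hs' (by simp [← h])
    · intro h; exact hs' (by simp [h])
  · rw [slabData_of_not_mem hmem]
    intro θ _
    simp

/-- The extended datum has mean-free slices if the datum has. [folklore] -/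
theorem hasZeroMean_slabData (hmean : ∀ t, Torus.HasZeroMean (u t)) (s : ℝ) :
    Torus.HasZeroMean (slabData T u s) := by
  by_cases hs : s ∈ Icc 0 (4 * T)
  · rw [slabData_of_mem hs]; exact hmean _
  · rw [slabData_of_not_mem hs]
    simp [Torus.HasZeroMean]

end SlabData

/-! ## Scalar bookkeeping -/

section Scalars

/-- Slices of bounded Hölder slab data are continuous. [folklore] -/
theorem holderSlabData_continuous_slice {U : ℝ → 𝕋³ → ℝ³} {M H β T₀ : ℝ} (hU : Torus.HolderSlabData U M H β T₀)
    {s : ℝ} (hs : s ∈ Icc 0 T₀) : Continuous (U s) := by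
  have hH := hU.H_nonneg
  have hβ := hU.β_pos
  have hW : HolderWith (Real.toNNReal H) (Real.toNNReal β) (U s) := by
    intro y y'
    have h := hU.holder s hs s hs y y'
    rw [sub_self, abs_zero, max_eq_right (norm_nonneg _), ← dist_eq_norm (U s y) (U s y'),
      ← dist_eq_norm y y'] at h
    rw [edist_dist, edist_dist, Real.coe_toNNReal β hβ.le]
    calc ENNReal.ofReal (dist (U s y) (U s y')) ≤ ENNReal.ofReal (H * dist y y' ^ β) := ENNReal.ofReal_le_ofReal h
      _ = ENNReal.ofReal H * ENNReal.ofReal (dist y y') ^ β := by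
          rw [ENNReal.ofReal_mul hH, ENNReal.ofReal_rpow_of_nonneg dist_nonneg hβ.le]
  exact hW.continuous (Real.toNNReal_pos.2 hβ)

/-- `x ^ y ≤ x ^ z` for `0 ≤ x ≤ 1` and `z ≤ y` with `0 < z` (also at `x = 0`). [folklore] -/
theorem rpow_le_rpow_of_base_le_one {x y z : ℝ} (hx0 : 0 ≤ x) (hx1 : x ≤ 1) (hz : 0 < z) (hzy : z ≤ y) :
    x ^ y ≤ x ^ z := by
  rcases eq_or_lt_of_le hx0 with h | h
  · subst h
    rw [Real.zero_rpow hz.ne', Real.zero_rpow (hz.trans_le hzy).ne']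
  · exact Real.rpow_le_rpow_of_exponent_ge h hx1 hzy

end Scalars

end BV2019

open BV2019

/-! ## The discharge -/
set_option maxHeartbeats 400000 in -- buildfix (bf3-g26): 160k/180k FAIL, 200k PASS at accept time; line-neutral budget line
/-- **Buckmaster–Vicol 2019, §2.5, (2.12)–(2.15) — discharged.** The space–time mollification
of the datum at scales `ε = τ = λ^{-1}`, shifted to `[0, T]`, with the pressure of its residual
and the traceless stress `(V ⊗ V - 𝒯 - ν(∇V + ∇Vᵀ))̊`, is the Navier–Stokes–Reynolds triple of
`BuckmasterVicol2019_mollifiedEulerStart` for every `0 < ν ≤ λ^{-1}`. [cite: BuckmasterVicol2019Annals, §2.5 (2.12)–(2.15)] -/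
theorem BuckmasterVicol2019_mollifiedEulerStart_holds : BuckmasterVicol2019_mollifiedEulerStart := by
  intro T hT βb hβ hβ1 u hHol hEul hmean β' hβ' hβ'2
  -- the data on the slab
  obtain ⟨M, H, hU⟩ := BV2019.exists_holderSlabData hT hβ hβ1 hHol
  have hEU : Torus.IsWeakEulerSolutionOn (4 * T) (slabData T u) := isWeakEulerSolutionOn_slabData hEul
  have hdivU := ae_isWeaklyDivFree_slabData hEU
  have hmeanU := hasZeroMean_slabData (T := T) hmean
  have hUm := hU.measurable
  have hUb := hU.bound
  have hU0 := hU.zero_off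
  have hUi := Torus.integrable_uncurry_of_bounded hUm hUb hU0
  have hM := hU.M_nonneg
  have hH := hU.H_nonneg
  have hβr : (0 : ℝ) < βb := by exact_mod_cast hβ
  -- the constants
  obtain ⟨C₁, hC₁⟩ : ∃ C₁ : ℝ, C₁ = Torus.gradProfileMass (Fin 3) := ⟨_, rfl⟩
  obtain ⟨C₂, hC₂⟩ : ∃ C₂ : ℝ, C₂ = Torus.derivProfileMass (Fin 3) 2 := ⟨_, rfl⟩
  obtain ⟨c, hc⟩ : ∃ c : ℝ, c = Torus.timeBumpDerivMass := ⟨_, rfl⟩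
  have hC₁0 : 0 ≤ C₁ := by rw [hC₁]; exact Torus.gradProfileMass_nonneg
  have hC₂0 : 0 ≤ C₂ := by rw [hC₂]; exact Torus.derivProfileMass_nonneg 2
  have hc0 : 0 ≤ c := by rw [hc]; exact Torus.timeBumpDerivMass_nonneg
  obtain ⟨r₀, hr₀⟩ : ∃ r₀ : ℝ, r₀ = (β' + βb) / 2 := ⟨_, rfl⟩
  have hr₀1 : β' < r₀ := by rw [hr₀]; linarith
  have hr₀2 : r₀ < βb := by rw [hr₀]; linarith
  have hr₀0 : 0 < r₀ := hβ'.trans hr₀1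
  obtain ⟨Ce, hCe0, hCe⟩ := Torus.eSobolevNorm_le_of_holder (F := EuclideanSpace ℂ (Fin 3)) (Fin 3) hβ'.le hr₀1
  obtain ⟨K₄, hK₄⟩ : ∃ K₄ : ℝ, K₄ = 4 * (3 * (4 * M * H) + 2 * (3 * (C₁ * H))) := ⟨_, rfl⟩
  obtain ⟨K₅, hK₅⟩ : ∃ K₅ : ℝ, K₅ = 4 * (2 * (3 * M) * (C₁ * H) + 3 * (C₁ * M ^ 2) + 2 * (3 * (C₂ * M))) := ⟨_, rfl⟩
  obtain ⟨K₆, hK₆⟩ : ∃ K₆ : ℝ, K₆ = 4 * (2 * (3 * M) * (c * M) + 3 * (c * M ^ 2) + 2 * (3 * (c * C₁ * M))) := ⟨_, rfl⟩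
  obtain ⟨K₇, hK₇⟩ : ∃ K₇ : ℝ, K₇ = 3 * M + Ce * (3 * H) := ⟨_, rfl⟩
  have hK₄0 : 0 ≤ K₄ := by rw [hK₄]; positivity
  have hK₅0 : 0 ≤ K₅ := by rw [hK₅]; positivity
  have hK₆0 : 0 ≤ K₆ := by rw [hK₆]; positivity
  have hK₇0 : 0 ≤ K₇ := by rw [hK₇]; positivity
  obtain ⟨C, hC⟩ : ∃ C : ℝ, C = 1 + 3 * M + 3 * (C₁ * H) + 3 * (c * M) + K₄ + K₅ + K₆ + K₇ := ⟨_, rfl⟩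
  have hP₁ : 0 ≤ 3 * M := by positivity
  have hP₂ : 0 ≤ 3 * (C₁ * H) := by positivity
  have hP₃ : 0 ≤ 3 * (c * M) := by positivity
  have hCK₁ : 3 * M ≤ C := by rw [hC]; linarith
  have hCK₂ : 3 * (C₁ * H) ≤ C := by rw [hC]; linarith
  have hCK₃ : 3 * (c * M) ≤ C := by rw [hC]; linarith
  have hCK₄ : K₄ ≤ C := by rw [hC]; linarith
  have hCK₅ : K₅ ≤ C := by rw [hC]; linarith
  have hCK₆ : K₆ ≤ C := by rw [hC]; linarith
  have hCK₇ : K₇ ≤ C := by rw [hC]; linarith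
  have hC1 : 1 ≤ C := by rw [hC]; linarith
  have hC0 : 0 ≤ C := by linarith
  refine ⟨C, hC1, fun η hη => ?_⟩
  -- the threshold
  obtain ⟨A, hA⟩ : ∃ A : ℝ, A = 3 * H + 6 * Ce * H + 1 := ⟨_, rfl⟩
  have hA0 : 0 < A := by rw [hA]; positivity
  obtain ⟨η', hη'⟩ : ∃ η' : ℝ, η' = η / A := ⟨_, rfl⟩
  have hη'0 : 0 < η' := by rw [hη']; exact div_pos hη hA0
  obtain ⟨e₀, he₀⟩ : ∃ e₀ : ℝ, e₀ = βb - r₀ := ⟨_, rfl⟩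
  have he₀0 : 0 < e₀ := by rw [he₀]; linarith
  obtain ⟨L₁, hL₁⟩ : ∃ L₁ : ℝ, L₁ = η'⁻¹ ^ e₀⁻¹ := ⟨_, rfl⟩
  have hL₁0 : 0 < L₁ := by rw [hL₁]; exact Real.rpow_pos_of_pos (inv_pos.2 hη'0) _
  refine ⟨4 + 2 / T + L₁, by have := div_pos two_pos hT; linarith, fun lam hlam ν hν hνlam => ?_⟩
  -- the scales
  have h2T : 0 < 2 / T := div_pos two_pos hT
  have hlam4 : 4 ≤ lam := by linarith
  have hlam0 : 0 < lam := by linarith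
  have hlamT : 2 / T ≤ lam := by linarith
  have hlamL : L₁ ≤ lam := by linarith
  obtain ⟨ε, hεdef⟩ : ∃ ε : ℝ, ε = lam⁻¹ := ⟨_, rfl⟩
  have hε : 0 < ε := by rw [hεdef]; exact inv_pos.2 hlam0
  have hε4 : ε ≤ 1 / 4 := by rw [hεdef, one_div]; exact inv_anti₀ four_pos hlam4
  have hε1 : ε ≤ 1 := hε4.trans (by norm_num)
  have hεT : ε ≤ T / 2 := by
    rw [hεdef]
    calc lam⁻¹ ≤ (2 / T)⁻¹ := inv_anti₀ h2T hlamT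
      _ = T / 2 := by rw [inv_div]
  have hεT' : ε < T := hεT.trans_lt (by linarith)
  have hν1 : |ν| * ε⁻¹ ≤ 1 := by
    rw [abs_of_pos hν, hεdef, inv_inv]
    calc ν * lam ≤ lam⁻¹ * lam := mul_le_mul_of_nonneg_right hνlam hlam0.le
      _ = 1 := inv_mul_cancel₀ hlam0.ne'
  have hν2 : |ν| * (ε ^ 2)⁻¹ ≤ ε⁻¹ := by
    have h : |ν| * (ε ^ 2)⁻¹ = |ν| * ε⁻¹ * ε⁻¹ := by rw [pow_two, mul_inv]; ring
    rw [h]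
    exact (mul_le_of_le_one_left (inv_nonneg.2 hε.le) hν1)
  have hεβ : ε ^ (βb : ℝ) ≤ 1 := Real.rpow_le_one hε.le hε1 hβr.le
  have hεβ0 : 0 ≤ ε ^ (βb : ℝ) := Real.rpow_nonneg hε.le _
  have hεlam : ε ^ (βb : ℝ) = lam ^ (-(βb : ℝ)) := by
    rw [hεdef, Real.inv_rpow hlam0.le, Real.rpow_neg hlam0.le]
  have hεinv : ε⁻¹ = lam := by rw [hεdef, inv_inv]
  have hmax : max ε ε = ε := max_self ε
  -- the smallness at the threshold: `ε^{e₀} ≤ η'`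
  have hsmall : ε ^ e₀ ≤ η' := by
    have h1 : ε ^ e₀ ≤ L₁⁻¹ ^ e₀ := by
      refine Real.rpow_le_rpow hε.le ?_ he₀0.le
      rw [hεdef]; exact inv_anti₀ hL₁0 hlamL
    refine h1.trans (le_of_eq ?_)
    rw [hL₁, Real.inv_rpow (Real.rpow_nonneg (inv_nonneg.2 hη'0.le) _), Real.rpow_inv_rpow (inv_nonneg.2 hη'0.le) he₀0.ne',
      inv_inv]
  -- the bump, the residual and its pressure
  obtain ⟨S, hSdef⟩ : ∃ S : Set ℝ, S = Ioo ε (4 * T - ε) := ⟨_, rfl⟩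
  have hS : IsOpen S := by rw [hSdef]; exact isOpen_Ioo
  have hflux : Torus.IsSmoothSpaceTimeOn S (Torus.mollifiedFlux (Torus.timeBump hε) ε (slabData T u)) := by
    have h := Torus.isSmoothSpaceTimeOn_mollifiedFlux (φ := Torus.timeBump hε) hUm hUb hU0 hε hε4 S 0
    simp only [add_zero] at h
    exact h
  have hG : Torus.IsSmoothSpaceTimeOn S (Torus.mollifiedEulerResidual (Torus.timeBump hε) ε (slabData T u)) :=
    (Torus.isSmoothSpaceTimeOn_timeDeriv_mollifiedField (φ := Torus.timeBump hε) hUm hUb hU0 hε hε4 S).add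
      (Torus.isSmoothSpaceTimeOn_tensorDivergence hflux hS.uniqueDiffOn)
  have horth : ∀ t ∈ S, ∀ w : 𝕋³ → ℝ³, Torus.IsSmooth w → Torus.IsDivFree w →
      ∫ x, ⟪Torus.mollifiedEulerResidual (Torus.timeBump hε) ε (slabData T u) t x, w x⟫_ℝ = 0 := by
    intro t ht w hw hdw
    rw [hSdef] at ht
    have ht1 : (Torus.timeBump hε).rOut < t := by rw [Torus.timeBump_rOut]; exact ht.1
    have ht2 : t + (Torus.timeBump hε).rOut < 4 * T := by rw [Torus.timeBump_rOut]; linarith [ht.2]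
    exact Torus.integral_inner_mollifiedEulerResidual_eq_zero hUm hUb hU0 hEU hε hε4 ht1 ht2 hw hdw
  obtain ⟨q, hq, hgrad, hqmean⟩ := Torus.exists_smooth_pressure_of_forall_integral_inner_eq_zero hS hG horth
  -- the shift and the windows
  obtain ⟨t₀, ht₀⟩ : ∃ t₀ : ℝ, t₀ = 2 * T := ⟨_, rfl⟩
  have hsub : ∀ t ∈ Icc 0 T, t + t₀ ∈ S := by
    intro t ht
    rw [hSdef, ht₀]
    exact ⟨by linarith [ht.1], by linarith [ht.2]⟩
  have hwin : ∀ t ∈ Icc 0 T, Icc (t + t₀ - ε) (t + t₀ + ε) ⊆ Icc 0 (4 * T) := by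
    intro t ht
    rw [ht₀]
    exact Icc_subset_Icc (by linarith [ht.1]) (by linarith [ht.2])
  have hslab : ∀ t ∈ Icc 0 T, t + t₀ ∈ Icc 0 (4 * T) := fun t ht =>
    ⟨by rw [ht₀]; linarith [ht.1], by rw [ht₀]; linarith [ht.2]⟩
  have hu_eq : ∀ t ∈ Icc 0 T, slabData T u (t + t₀) = u t := by
    intro t ht
    rw [slabData_of_mem (hslab t ht), ht₀]
    congr 1; ring
  -- notation for the velocity
  have hV3 := Torus.norm_mollifiedField_bounds hU hε hε hε4
  simp only [Fintype.card_fin, Nat.cast_ofNat, hmax] at hV3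
  obtain ⟨hVsup, hVU, hVtr⟩ := hV3
  -- the triple
  refine ⟨Torus.startVelocity (Torus.timeBump hε) ε (slabData T u) t₀, Torus.startPressure (Torus.timeBump hε) ε ν (slabData T u) q t₀,
    Torus.startStress (Torus.timeBump hε) ε ν (slabData T u) t₀,
    Torus.isNSReynoldsOn_start hUm hUb hU0 hε hε4 hdivU hq hgrad hqmean ν hT hsub,
    fun t _ => Torus.hasZeroMean_mollifiedField hUm hUb hU0 hmeanU hε hε4 (t + t₀),
    fun t _ x => ?_, fun i t ht x => ?_, fun t ht x => ?_, fun t ht x => ?_, fun i t ht x => ?_, fun t ht x => ?_,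
    fun t ht => ?_, fun t ht => ?_⟩
  · -- ‖v‖ ≤ C
    exact ((hVsup (t + t₀) x).trans (by norm_num)).trans hCK₁
  · -- ‖∂ᵢ v‖ ≤ C λ
    have h := Torus.norm_partialDeriv_mollifiedField_le hU hε hε hε4 (hwin t ht) x i
    simp only [Fintype.card_fin, Nat.cast_ofNat, hmax, ← hC₁] at h
    refine h.trans ?_
    calc (3 : ℝ) * (ε⁻¹ * C₁ * (H * ε ^ (βb : ℝ))) ≤ 3 * (ε⁻¹ * C₁ * (H * 1)) := by
          gcongr
      _ = 3 * (C₁ * H) * lam := by rw [hεinv]; ring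
      _ ≤ C * lam := mul_le_mul_of_nonneg_right hCK₂ hlam0.le
  · -- ‖∂ₜ v‖ ≤ C λ
    have hd := (Torus.hasDerivAt_mollifiedField (φ := Torus.timeBump hε) hUm hUi hε hε4 (t + t₀) x).comp_add_const t t₀
    have hD : Torus.timeDerivWithin (Icc 0 T) (Torus.startVelocity (Torus.timeBump hε) ε (slabData T u) t₀) t x =
        Torus.timeDeriv (Torus.mollifiedField (Torus.timeBump hε) ε (slabData T u)) (t + t₀) x := by
      rw [Torus.timeDerivWithin, Torus.timeDeriv, (Torus.hasDerivAt_mollifiedField (φ := Torus.timeBump hε) hUm hUi hε hε4 (t + t₀) x).deriv]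
      exact hd.hasDerivWithinAt.derivWithin (uniqueDiffOn_Icc hT t ht)
    rw [hD]
    have h := Torus.norm_timeDeriv_mollifiedField_le hU hε hε hε4 (t + t₀) x
    simp only [Fintype.card_fin, Nat.cast_ofNat, ← hc] at h
    refine h.trans ?_
    calc (3 : ℝ) * (ε⁻¹ * c * M) = 3 * (c * M) * lam := by rw [hεinv]; ring
      _ ≤ C * lam := mul_le_mul_of_nonneg_right hCK₃ hlam0.le
  · -- ‖R̊‖ ≤ C λ^{-β̄}
    have h := Torus.norm_startStress_le hU hε hε hε4 ν (hwin t ht) x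
    simp only [Fintype.card_fin, Nat.cast_ofNat, hmax, ← hC₁] at h
    refine h.trans ?_
    have h1 : |ν| * (2 * (3 * (ε⁻¹ * C₁ * (H * ε ^ (βb : ℝ))))) ≤ 2 * (3 * (C₁ * H)) * ε ^ (βb : ℝ) := by
      have : |ν| * (2 * (3 * (ε⁻¹ * C₁ * (H * ε ^ (βb : ℝ))))) = (|ν| * ε⁻¹) * (2 * (3 * (C₁ * H)) * ε ^ (βb : ℝ)) := by ring
      rw [this]
      exact mul_le_of_le_one_left (by positivity) hν1
    calc ((3 : ℝ) + 1) * (3 * (4 * M * H * ε ^ (βb : ℝ)) + |ν| * (2 * (3 * (ε⁻¹ * C₁ * (H * ε ^ (βb : ℝ))))))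
        ≤ (3 + 1) * (3 * (4 * M * H * ε ^ (βb : ℝ)) + 2 * (3 * (C₁ * H)) * ε ^ (βb : ℝ)) := by gcongr
      _ = K₄ * ε ^ (βb : ℝ) := by rw [hK₄]; ring
      _ ≤ C * lam ^ (-(βb : ℝ)) := by rw [← hεlam]; exact mul_le_mul_of_nonneg_right hCK₄ hεβ0
  · -- ‖∂ᵢ R̊‖ ≤ C λ
    have h := Torus.norm_partialDeriv_startStress_le hU hε hε hε4 ν (hwin t ht) x i
    simp only [Fintype.card_fin, Nat.cast_ofNat, hmax, ← hC₁, ← hC₂] at h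
    refine h.trans ?_
    have h1 : 2 * (3 * M) * (ε⁻¹ * C₁ * (H * ε ^ (βb : ℝ))) ≤ 2 * (3 * M) * (C₁ * H) * ε⁻¹ := by
      have : 2 * (3 * M) * (ε⁻¹ * C₁ * (H * ε ^ (βb : ℝ))) = (2 * (3 * M) * (C₁ * H) * ε⁻¹) * ε ^ (βb : ℝ) := by ring
      rw [this]
      exact mul_le_of_le_one_right (by positivity) hεβ
    have h2 : |ν| * (2 * (3 * ((ε ^ 2)⁻¹ * C₂ * M))) ≤ 2 * (3 * (C₂ * M)) * ε⁻¹ := by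
      have : |ν| * (2 * (3 * ((ε ^ 2)⁻¹ * C₂ * M))) = (|ν| * (ε ^ 2)⁻¹) * (2 * (3 * (C₂ * M))) := by ring
      rw [this, mul_comm (2 * (3 * (C₂ * M)))]
      exact mul_le_mul_of_nonneg_right hν2 (by positivity)
    calc ((3 : ℝ) + 1) * (2 * (3 * M) * (ε⁻¹ * C₁ * (H * ε ^ (βb : ℝ))) + 3 * (ε⁻¹ * C₁ * M ^ 2) +
          |ν| * (2 * (3 * ((ε ^ 2)⁻¹ * C₂ * M))))
        ≤ (3 + 1) * (2 * (3 * M) * (C₁ * H) * ε⁻¹ + 3 * (ε⁻¹ * C₁ * M ^ 2) + 2 * (3 * (C₂ * M)) * ε⁻¹) := by gcongr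
      _ = K₅ * lam := by rw [hK₅, hεinv]; ring
      _ ≤ C * lam := mul_le_mul_of_nonneg_right hCK₅ hlam0.le
  · -- ‖∂ₜ R̊‖ ≤ C λ
    obtain ⟨D, hD, hDb⟩ := Torus.hasDerivAt_startStress hU hε hε hε4 ν t₀ t x
    have hDw : Torus.timeDerivWithin (Icc 0 T) (Torus.startStress (Torus.timeBump hε) ε ν (slabData T u) t₀) t x = D :=
      hD.hasDerivWithinAt.derivWithin (uniqueDiffOn_Icc hT t ht)
    rw [hDw]
    simp only [Fintype.card_fin, Nat.cast_ofNat, ← hC₁, ← hc] at hDb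
    refine hDb.trans ?_
    have h2 : |ν| * (2 * (3 * (ε⁻¹ * c * (ε⁻¹ * C₁) * M))) ≤ 2 * (3 * (c * C₁ * M)) * ε⁻¹ := by
      have : |ν| * (2 * (3 * (ε⁻¹ * c * (ε⁻¹ * C₁) * M))) = (|ν| * ε⁻¹) * (2 * (3 * (c * C₁ * M)) * ε⁻¹) := by ring
      rw [this]
      exact mul_le_of_le_one_left (by positivity) hν1
    calc ((3 : ℝ) + 1) * (2 * (3 * M) * (ε⁻¹ * c * M) + 3 * (ε⁻¹ * c * M ^ 2) + |ν| * (2 * (3 * (ε⁻¹ * c * (ε⁻¹ * C₁) * M))))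
        ≤ (3 + 1) * (2 * (3 * M) * (ε⁻¹ * c * M) + 3 * (ε⁻¹ * c * M ^ 2) + 2 * (3 * (c * C₁ * M)) * ε⁻¹) := by gcongr
      _ = K₆ * lam := by rw [hK₆, hεinv]; ring
      _ ≤ C * lam := mul_le_mul_of_nonneg_right hCK₆ hlam0.le
  · -- `H^{β'}`-closeness (2.15)
    have ht' := hslab t ht
    have hVc : Continuous (Torus.mollifiedField (Torus.timeBump hε) ε (slabData T u) (t + t₀)) :=
      (Torus.isSmooth_mollifiedField hUi hε hε4 (t + t₀)).continuous
    have hUc : Continuous (slabData T u (t + t₀)) := holderSlabData_continuous_slice hU ht'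
    have hfg : EuclideanSpace.complexify ∘ (Torus.startVelocity (Torus.timeBump hε) ε (slabData T u) t₀ t - u t) =
        fun x => EuclideanSpace.complexify (Torus.mollifiedField (Torus.timeBump hε) ε (slabData T u) (t + t₀) x - slabData T u (t + t₀) x) := by
      funext x
      rw [Function.comp_apply, Pi.sub_apply, hu_eq t ht]
      rfl
    rw [hfg]
    have hfc : Continuous fun x => EuclideanSpace.complexify
        (Torus.mollifiedField (Torus.timeBump hε) ε (slabData T u) (t + t₀) x - slabData T u (t + t₀) x) :=
      EuclideanSpace.continuous_complexify.comp (hVc.sub hUc)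
    -- sup bound `3 H ε^β̄`
    have hfsup : ∀ x, ‖EuclideanSpace.complexify
        (Torus.mollifiedField (Torus.timeBump hε) ε (slabData T u) (t + t₀) x - slabData T u (t + t₀) x)‖ ≤ 3 * (H * ε ^ (βb : ℝ)) := by
      intro x
      rw [EuclideanSpace.norm_complexify]
      exact hVU (t + t₀) (hwin t ht) x
    -- Hölder modulus `6 H ε^{β̄ - r₀}` at exponent `r₀`
    have hfmod : ∀ x y, ‖EuclideanSpace.complexify
        (Torus.mollifiedField (Torus.timeBump hε) ε (slabData T u) (t + t₀) x - slabData T u (t + t₀) x) - EuclideanSpace.complexify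
        (Torus.mollifiedField (Torus.timeBump hε) ε (slabData T u) (t + t₀) y - slabData T u (t + t₀) y)‖ ≤ 6 * H * ε ^ e₀ * dist x y ^ r₀ := by
      intro x y
      have hxy0 : 0 ≤ dist x y := dist_nonneg
      rw [← map_sub, EuclideanSpace.norm_complexify]
      by_cases hd : dist x y ≤ ε
      · -- near the diagonal: Hölder moduli of `V` and `U`
        have h1 : ‖Torus.mollifiedField (Torus.timeBump hε) ε (slabData T u) (t + t₀) x - Torus.mollifiedField (Torus.timeBump hε) ε (slabData T u) (t + t₀) y‖ ≤
            3 * (H * dist x y ^ (βb : ℝ)) := by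
          have h := hVtr (t + t₀) x (y - x)
          rw [add_sub_cancel, ← dist_eq_norm y x, dist_comm y x] at h
          exact h
        have h2 : ‖slabData T u (t + t₀) x - slabData T u (t + t₀) y‖ ≤ H * dist x y ^ (βb : ℝ) := by
          have h := hU.holder (t + t₀) ht' (t + t₀) ht' x y
          rw [sub_self, abs_zero, max_eq_right (norm_nonneg _), ← dist_eq_norm x y] at h
          exact h
        have hsplit : Torus.mollifiedField (Torus.timeBump hε) ε (slabData T u) (t + t₀) x - slabData T u (t + t₀) x -
            (Torus.mollifiedField (Torus.timeBump hε) ε (slabData T u) (t + t₀) y - slabData T u (t + t₀) y) =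
            (Torus.mollifiedField (Torus.timeBump hε) ε (slabData T u) (t + t₀) x - Torus.mollifiedField (Torus.timeBump hε) ε (slabData T u) (t + t₀) y) -
              (slabData T u (t + t₀) x - slabData T u (t + t₀) y) := by abel
        rw [hsplit]
        refine (norm_sub_le _ _).trans ((add_le_add h1 h2).trans ?_)
        have hpow : dist x y ^ (βb : ℝ) = dist x y ^ e₀ * dist x y ^ r₀ := by
          rw [← Real.rpow_add_of_nonneg hxy0 he₀0.le hr₀0.le, he₀, sub_add_cancel]
        have hle : dist x y ^ e₀ ≤ ε ^ e₀ := Real.rpow_le_rpow hxy0 hd he₀0.le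
        calc 3 * (H * dist x y ^ (βb : ℝ)) + H * dist x y ^ (βb : ℝ) = 4 * H * (dist x y ^ e₀ * dist x y ^ r₀) := by
              rw [hpow]; ring
          _ ≤ 4 * H * (ε ^ e₀ * dist x y ^ r₀) := by gcongr
          _ ≤ 6 * H * (ε ^ e₀ * dist x y ^ r₀) := by gcongr; norm_num
          _ = 6 * H * ε ^ e₀ * dist x y ^ r₀ := by ring
      · -- far from the diagonal: two sup bounds
        push Not at hd
        have h1 := hVU (t + t₀) (hwin t ht) x
        have h2 := hVU (t + t₀) (hwin t ht) y
        refine (norm_sub_le _ _).trans ((add_le_add h1 h2).trans ?_)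
        have hpow : ε ^ (βb : ℝ) = ε ^ e₀ * ε ^ r₀ := by
          rw [← Real.rpow_add hε, he₀, sub_add_cancel]
        have hle : ε ^ r₀ ≤ dist x y ^ r₀ := Real.rpow_le_rpow hε.le hd.le hr₀0.le
        calc 3 * (H * ε ^ (βb : ℝ)) + 3 * (H * ε ^ (βb : ℝ)) = 6 * H * ε ^ e₀ * ε ^ r₀ := by rw [hpow]; ring
          _ ≤ 6 * H * ε ^ e₀ * dist x y ^ r₀ := by gcongr
    have hL0 : 0 ≤ 6 * H * ε ^ e₀ := by positivity
    have hM0 : 0 ≤ 3 * (H * ε ^ (βb : ℝ)) := by positivity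
    refine (hCe _ hfc _ _ hM0 hL0 hfsup hfmod).trans (ENNReal.ofReal_le_ofReal ?_)
    -- `3Hε^β̄ + Ce·6Hε^{e₀} ≤ (3H + 6CeH) ε^{e₀} ≤ A η' = η`
    have hεe : ε ^ (βb : ℝ) ≤ ε ^ e₀ := rpow_le_rpow_of_base_le_one hε.le hε1 he₀0 (by rw [he₀]; linarith)
    calc 3 * (H * ε ^ (βb : ℝ)) + Ce * (6 * H * ε ^ e₀) ≤ 3 * (H * ε ^ e₀) + Ce * (6 * H * ε ^ e₀) := by gcongr
      _ = (3 * H + 6 * Ce * H) * ε ^ e₀ := by ring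
      _ ≤ (3 * H + 6 * Ce * H) * η' := by gcongr
      _ ≤ A * η' := by gcongr; rw [hA]; linarith
      _ = η := by rw [hη']; field_simp
  · -- `H^{β'}` bound of `v`
    have hVc : Continuous (Torus.mollifiedField (Torus.timeBump hε) ε (slabData T u) (t + t₀)) :=
      (Torus.isSmooth_mollifiedField hUi hε hε4 (t + t₀)).continuous
    show Torus.eSobolevNorm β' (fun x => EuclideanSpace.complexify (Torus.mollifiedField (Torus.timeBump hε) ε (slabData T u) (t + t₀) x)) ≤ _
    have hfc : Continuous fun x => EuclideanSpace.complexify (Torus.mollifiedField (Torus.timeBump hε) ε (slabData T u) (t + t₀) x) :=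
      EuclideanSpace.continuous_complexify.comp hVc
    have hfsup : ∀ x, ‖EuclideanSpace.complexify (Torus.mollifiedField (Torus.timeBump hε) ε (slabData T u) (t + t₀) x)‖ ≤ 3 * M := fun x => by
      rw [EuclideanSpace.norm_complexify]; exact hVsup (t + t₀) x
    have hfmod : ∀ x y, ‖EuclideanSpace.complexify (Torus.mollifiedField (Torus.timeBump hε) ε (slabData T u) (t + t₀) x) -
        EuclideanSpace.complexify (Torus.mollifiedField (Torus.timeBump hε) ε (slabData T u) (t + t₀) y)‖ ≤ 3 * H * dist x y ^ r₀ := by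
      intro x y
      rw [← map_sub, EuclideanSpace.norm_complexify]
      have h := hVtr (t + t₀) x (y - x)
      rw [add_sub_cancel, ← dist_eq_norm y x, dist_comm y x] at h
      refine h.trans ?_
      have hd1 : dist x y ≤ 1 := (Torus.dist_le_half x y).trans (by norm_num)
      calc 3 * (H * dist x y ^ (βb : ℝ)) ≤ 3 * (H * dist x y ^ r₀) :=
            mul_le_mul_of_nonneg_left (mul_le_mul_of_nonneg_left
              (rpow_le_rpow_of_base_le_one dist_nonneg hd1 hr₀0 hr₀2.le) hH) (by norm_num)
        _ = 3 * H * dist x y ^ r₀ := by ring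
    refine (hCe _ hfc (3 * M) (3 * H) (by positivity) (by positivity) hfsup hfmod).trans (ENNReal.ofReal_le_ofReal ?_)
    calc 3 * M + Ce * (3 * H) = K₇ := by rw [hK₇]
      _ ≤ C := hCK₇

end Literature.Barriers.AnomalousDissipation

end
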